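import Summits.Ventures.PercRepro.C026PFunHalfEM

/-!
# The pendant probe: clusters, sums and the termwise identities (p6, gen 16; mine-3 §28 (i), one child)

Let the probe `c` be a LEAF of the skeleton `(G, F)`: its only edge `e ∈ F` joins it to `u ≠ c`
(`IsLeafAt G F e c u`).  Write, for the sub-skeleton `(G, F − e)` with probe `u` (in which `c` is an
isolated vertex), `m̂ = ∑_ω N_u(ω)`, `ẑ = ∑_ω X_u(ω)N_u(ω)` (`mSum`, `zSum`) and `P_u = (P_{F−e})` with
probe `u`.  Then (`IsLeafAt.pFun_eq`)

`(2 − x_c)·(P_F) = (3 − 4x_c)m̂ − ẑ + K_c(x_c m̂ + (4 − 3x_c)ẑ) + (2 − x_c)K_c·P_u`,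

i.e. `(P_F) = m̂·[(3 − ξ) − 4x_c + 2K_c(π̃ + 2ξ) − K_c x_c(π̃ + 3ξ − 1)]` with the VIRTUAL COMPONENT
`ξ = ẑ/m̂`, `π̃ = P_u/m̂` (mine-3 §28 (i) for a single subtree): splitting every configuration by `e`,
the closed configurations are those of `F − e` with `c` isolated, the open ones glue `c` to `u`'s
cluster (the merge lemma), and the complement of a closed configuration is the open one of its
complement; the `K_u`-cross sum of the sub-skeleton is `P_u − (m̂ − 2ẑ)`.
-/

namespace PercRepro

namespace MultiGraph

open Finset

variable {V E : Type*} [Fintype V] [DecidableEq V] [Fintype E] [DecidableEq E] {G : MultiGraph V E}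

/-- `IsLeafAt G F e c u`: the edge `e ∈ F` joins the probe `c` to `u ≠ c`, and no other edge of `F`
touches `c`. -/
structure IsLeafAt (G : MultiGraph V E) (F : Finset E) (e : E) (c u : V) : Prop where
  mem : e ∈ F
  fst : G.fst e = c
  snd : G.snd e = u
  ne : u ≠ c
  avoid : ∀ f ∈ F, f ≠ e → G.fst f ≠ c ∧ G.snd f ≠ c

section Sums

variable (G) in
/-- `m̂ = ∑_{ω ⊆ F} N_u(ω)`: the piece sum of the skeleton with probe `u`. -/
noncomputable def mSum (x : V → ℝ) (u : V) (F : Finset E) : ℝ :=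
  ∑ ω ∈ configsIn F, G.nbarOff x u ω

variable (G) in
/-- `ẑ = ∑_{ω ⊆ F} X_u(ω)·N_u(ω)`. -/
noncomputable def zSum (x : V → ℝ) (u : V) (F : Finset E) : ℝ :=
  ∑ ω ∈ configsIn F, G.xCluster x u ω * G.nbarOff x u ω

/-- `0 ≤ ẑ ≤ m̂` for cells in `[0, 1]`. -/
theorem zSum_le_mSum {x : V → ℝ} (hx : ∀ v, 0 ≤ x v ∧ x v ≤ 1) (u : V) (F : Finset E) :
    0 ≤ G.zSum x u F ∧ G.zSum x u F ≤ G.mSum x u F := by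
  unfold zSum mSum
  constructor
  · exact Finset.sum_nonneg fun ω _ => mul_nonneg (xCluster_mem hx u ω).1 (nbarOff_nonneg hx u ω)
  · exact Finset.sum_le_sum fun ω _ =>
      mul_le_of_le_one_left (nbarOff_nonneg hx u ω) (xCluster_mem hx u ω).2

/-- `m̂ ≥ 1` for cells in `[0, 1]` (the all-closed configuration alone contributes `≥ 1`). -/
theorem one_le_mSum {x : V → ℝ} (hx : ∀ v, 0 ≤ x v ∧ x v ≤ 1) (u : V) (F : Finset E) :
    1 ≤ G.mSum x u F := by
  unfold mSum
  have hmem : (fun _ : E => false) ∈ configsIn F := mem_configsIn.2 fun e he => absurd he Bool.false_ne_true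
  calc (1 : ℝ) ≤ G.nbarOff x u (fun _ => false) := one_le_nbarOff hx u _
    _ = ∑ ω ∈ {fun _ : E => false}, G.nbarOff x u ω := by rw [Finset.sum_singleton]
    _ ≤ ∑ ω ∈ configsIn F, G.nbarOff x u ω :=
      Finset.sum_le_sum_of_subset_of_nonneg (Finset.singleton_subset_iff.2 hmem)
        fun ω _ _ => nbarOff_nonneg hx u ω

/-- `(P) ≥ m̂ − 2ẑ`: the `K`-part is nonnegative. -/
theorem mSum_sub_two_zSum_le_pFun {x K : V → ℝ} (hx : ∀ v, 0 ≤ x v ∧ x v ≤ 1) (hK : ∀ v, 0 ≤ K v)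
    (u : V) (F : Finset E) : G.mSum x u F - 2 * G.zSum x u F ≤ G.pFun u x K F := by
  unfold mSum zSum pFun
  rw [Finset.mul_sum, ← Finset.sum_sub_distrib]
  refine Finset.sum_le_sum fun ω _ => ?_
  have : 0 ≤ G.kCluster K u ω * G.nbar x (complIn F ω) :=
    mul_nonneg (kCluster_nonneg hK u ω) (nbar_nonneg hx _)
  nlinarith

end Sums

section Split

omit [Fintype V] [DecidableEq V] [Fintype E] in
/-- The complement inside `F` of a configuration with `e` opened is the complement inside `F − e`. -/
theorem complIn_update_true (F : Finset E) (e : E) (ω : Config E) :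
    complIn F (Function.update ω e true) = complIn (F.erase e) ω := by
  funext f
  by_cases hf : f = e
  · subst hf
    simp [complIn]
  · simp [complIn, Finset.mem_erase, hf]

omit [Fintype V] [DecidableEq V] in
/-- A sum over the configurations inside `F` splits by the edge `e ∈ F`: the configurations with `e`
closed are those of `F − e`, the ones with `e` open are those of `F − e` with `e` opened. -/
theorem sum_configsIn_split {F : Finset E} {e : E} (he : e ∈ F) (f : Config E → ℝ) :
    ∑ ω ∈ configsIn F, f ω =
      ∑ ω ∈ configsIn (F.erase e), f ω + ∑ ω ∈ configsIn (F.erase e), f (Function.update ω e true) := by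
  rw [← Finset.sum_filter_add_sum_filter_not (configsIn F) (fun ω : Config E => ω e = false),
    configsIn_filter_eq_false]
  congr 1
  refine Finset.sum_nbij' (fun ω => Function.update ω e false) (fun ω => Function.update ω e true)
    ?_ ?_ ?_ ?_ ?_
  · intro ω hω
    rw [Finset.mem_filter, mem_configsIn] at hω
    rw [mem_configsIn]
    intro f hf
    by_cases hfe : f = e
    · subst hfe
      simp at hf
    · rw [Function.update_of_ne hfe] at hf
      exact Finset.mem_erase.2 ⟨hfe, hω.1 f hf⟩
  · intro ω hω
    rw [mem_configsIn] at hω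
    rw [Finset.mem_filter, mem_configsIn]
    refine ⟨fun f hf => ?_, by simp⟩
    by_cases hfe : f = e
    · subst hfe
      exact he
    · rw [Function.update_of_ne hfe] at hf
      exact Finset.mem_of_mem_erase (hω f hf)
  · intro ω hω
    rw [Finset.mem_filter] at hω
    have : ω e = true := by
      cases h : ω e
      · exact absurd h hω.2
      · rfl
    rw [Function.update_idem, ← this, Function.update_eq_self]
  · intro ω hω
    rw [mem_configsIn] at hω
    have : ω e = false := by
      cases h : ω e
      · rfl
      · exact absurd (Finset.ne_of_mem_erase (hω e h)) fun h' => h' rfl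
    rw [Function.update_idem, ← this, Function.update_eq_self]
  · intro ω hω
    rw [Finset.mem_filter] at hω
    have : ω e = true := by
      cases h : ω e
      · exact absurd h hω.2
      · rfl
    rw [Function.update_idem, ← this, Function.update_eq_self]

end Split

section Leaf

variable {F : Finset E} {e : E} {c u : V} (h : IsLeafAt G F e c u)
include h

omit [Fintype V] [DecidableEq V] in
/-- With `e` closed, no open edge touches the leaf probe. -/
theorem IsLeafAt.isolated {ω : Config E} (hω : ω ∈ configsIn (F.erase e)) :
    ∀ f, ω f = true → G.fst f ≠ c ∧ G.snd f ≠ c := by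
  intro f hf
  have hmem := (mem_configsIn.1 hω) f hf
  exact h.avoid f (Finset.mem_of_mem_erase hmem) (Finset.ne_of_mem_erase hmem)

omit [DecidableEq V] in
/-- With `e` closed, the cluster of the leaf probe is `{c}`. -/
theorem IsLeafAt.clusterF_closed {ω : Config E} (hω : ω ∈ configsIn (F.erase e)) :
    G.clusterF ω c = {c} := by
  ext v
  rw [mem_clusterF, Finset.mem_singleton]
  constructor
  · exact fun hv => eq_of_conn_of_isolated (h.isolated hω) hv
  · rintro rfl
    exact Conn.refl G ω v

omit [Fintype V] [DecidableEq V] in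
/-- With `e` closed, the leaf probe is not connected to `u`. -/
theorem IsLeafAt.not_conn {ω : Config E} (hω : ω ∈ configsIn (F.erase e)) :
    ¬ G.Conn ω (G.fst e) (G.snd e) := by
  rw [h.fst, h.snd]
  exact fun hc => h.ne (eq_of_conn_of_isolated (h.isolated hω) hc)

omit [DecidableEq V] in
/-- With `e` closed, `c` is not in the cluster of `u`. -/
theorem IsLeafAt.notMem_clusterF_u {ω : Config E} (hω : ω ∈ configsIn (F.erase e)) :
    c ∉ G.clusterF ω u := by
  rw [mem_clusterF]
  intro hc
  exact h.ne (eq_of_conn_of_isolated (h.isolated hω) hc.symm)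

/-- Opening `e` glues the leaf probe to the cluster of `u`. -/
theorem IsLeafAt.clusterF_open {ω : Config E} (hω : ω ∈ configsIn (F.erase e)) :
    G.clusterF (Function.update ω e true) c = insert c (G.clusterF ω u) := by
  have h1 := clusterF_update_true_of_conn_fst (h.not_conn hω) (v := c) (by rw [h.fst]; exact Conn.refl G ω c)
  rw [h1, h.fst, h.snd, h.clusterF_closed hω, Finset.singleton_union]

/-- Opening `e`: the set of clusters. -/
theorem IsLeafAt.clusters_open {ω : Config E} (hω : ω ∈ configsIn (F.erase e)) :
    G.clusters (Function.update ω e true) =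
      insert (insert c (G.clusterF ω u)) (((G.clusters ω).erase {c}).erase (G.clusterF ω u)) := by
  rw [clusters_update_true_of_not_conn (h.not_conn hω), h.fst, h.snd, h.clusterF_closed hω,
    Finset.singleton_union]

variable (x K : V → ℝ)

omit [DecidableEq V] in
/-- With `e` closed, `X_c = x c`. -/
theorem IsLeafAt.xCluster_closed {ω : Config E} (hω : ω ∈ configsIn (F.erase e)) :
    G.xCluster x c ω = x c := by
  unfold xCluster
  rw [h.clusterF_closed hω, Finset.prod_singleton]

omit [DecidableEq V] in
/-- With `e` closed, `K_c = K c`. -/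
theorem IsLeafAt.kCluster_closed {ω : Config E} (hω : ω ∈ configsIn (F.erase e)) :
    G.kCluster K c ω = K c := by
  unfold kCluster
  rw [h.clusterF_closed hω, Finset.prod_singleton]

/-- With `e` closed, `(2 − x_c)·N_c(ω) = n̄(ω) = (2 − X_u(ω))·N_u(ω)`. -/
theorem IsLeafAt.nbarOff_closed {ω : Config E} (hω : ω ∈ configsIn (F.erase e)) :
    (2 - x c) * G.nbarOff x c ω = (2 - G.xCluster x u ω) * G.nbarOff x u ω := by
  rw [← nbar_eq_mul_nbarOff G x u, nbar_eq_mul_nbarOff G x c, h.xCluster_closed x hω]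

/-- With `e` open, `X_c = x_c·X_u`. -/
theorem IsLeafAt.xCluster_open {ω : Config E} (hω : ω ∈ configsIn (F.erase e)) :
    G.xCluster x c (Function.update ω e true) = x c * G.xCluster x u ω := by
  unfold xCluster
  rw [h.clusterF_open hω, Finset.prod_insert (h.notMem_clusterF_u hω)]

/-- With `e` open, `K_c = K_c·K_u`. -/
theorem IsLeafAt.kCluster_open {ω : Config E} (hω : ω ∈ configsIn (F.erase e)) :
    G.kCluster K c (Function.update ω e true) = K c * G.kCluster K u ω := by
  unfold kCluster
  rw [h.clusterF_open hω, Finset.prod_insert (h.notMem_clusterF_u hω)]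

/-- With `e` open, `(2 − x_c)·N_c(ω + e) = N_u(ω)`: the pieces of the glued configuration are the
pieces of `u`'s configuration without the isolated `c`. -/
theorem IsLeafAt.nbarOff_open {ω : Config E} (hω : ω ∈ configsIn (F.erase e)) :
    (2 - x c) * G.nbarOff x c (Function.update ω e true) = G.nbarOff x u ω := by
  unfold nbarOff
  rw [h.clusters_open hω, h.clusterF_open hω, Finset.erase_insert, Finset.erase_right_comm]
  · have hc : ({c} : Finset V) ∈ (G.clusters ω).erase (G.clusterF ω u) := by
      refine Finset.mem_erase.2 ⟨?_, ?_⟩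
      · intro heq
        exact h.notMem_clusterF_u hω (heq ▸ Finset.mem_singleton_self c)
      · rw [← h.clusterF_closed hω]
        exact clusterF_mem_clusters ω c
    rw [← Finset.mul_prod_erase _ _ hc, Finset.prod_singleton]
  · intro hmem
    have hmem' := Finset.mem_of_mem_erase (Finset.mem_of_mem_erase hmem)
    obtain ⟨v, hv⟩ := mem_clusters.1 hmem'
    have hcv : c ∈ G.clusterF ω v := hv ▸ Finset.mem_insert_self c _
    have huv : u ∈ G.clusterF ω v := hv ▸ Finset.mem_insert_of_mem (self_mem_clusterF ω u)
    have hcu : G.Conn ω u c := (mem_clusterF.1 huv).symm.trans (mem_clusterF.1 hcv)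
    exact h.notMem_clusterF_u hω (mem_clusterF.2 hcu)

/-- The closed configurations of the leaf recursion, termwise. -/
theorem IsLeafAt.closed_term {ω : Config E} (hω : ω ∈ configsIn (F.erase e)) :
    (2 - x c) * (G.nbarOff x c ω * (1 - 2 * G.xCluster x c ω) +
        G.kCluster K c ω * G.nbar x (complIn F ω)) =
      (2 - G.xCluster x u ω) * G.nbarOff x u ω * (1 - 2 * x c) +
        K c * ((2 - x c * G.xCluster x u (complIn (F.erase e) ω)) *
          G.nbarOff x u (complIn (F.erase e) ω)) := by
  have hω' : complIn (F.erase e) ω ∈ configsIn (F.erase e) := complIn_mem_configsIn _ ω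
  rw [complIn_eq_update_of_mem h.mem hω, nbar_eq_mul_nbarOff G x c, h.xCluster_open x hω',
    h.xCluster_closed x hω, h.kCluster_closed K hω]
  have h1 := h.nbarOff_closed x hω
  have h2 := h.nbarOff_open x hω'
  linear_combination (1 - 2 * x c) * h1 +
    K c * (2 - x c * G.xCluster x u (complIn (F.erase e) ω)) * h2

/-- The open configurations of the leaf recursion, termwise. -/
theorem IsLeafAt.open_term {ω : Config E} (hω : ω ∈ configsIn (F.erase e)) :
    (2 - x c) * (G.nbarOff x c (Function.update ω e true) *
        (1 - 2 * G.xCluster x c (Function.update ω e true)) +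
        G.kCluster K c (Function.update ω e true) *
          G.nbar x (complIn F (Function.update ω e true))) =
      G.nbarOff x u ω * (1 - 2 * (x c * G.xCluster x u ω)) +
        (2 - x c) * (K c * G.kCluster K u ω) * G.nbar x (complIn (F.erase e) ω) := by
  rw [complIn_update_true, h.xCluster_open x hω, h.kCluster_open K hω]
  have h2 := h.nbarOff_open x hω
  linear_combination (1 - 2 * (x c * G.xCluster x u ω)) * h2

end Leaf

end MultiGraph

end PercRepro
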